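import Summits.BirchSwinnertonDyer.BirchSwinnertonDyer.Theorems.InertBadSignedBranchesAssemblyOfEtaMC
import Literature.NumberTheory.EllipticCurves.BurungaleTian2026.EtaSignedMainConjectureMuCriterionProofs
import HarnessLib

/-!
# Route `InertBadSignedBranches` (rung K8) — the leaf `X12.CMInertBad` WITHOUT the named fact
# Kobayashi 2003 Thm. 7.4 (η): its only use in the `closes` cone is at the CM twin `V = C • W^{(p*)}`,
# where the LANDED theorem `BurungaleTian2026.thm74_etaEvenMC_iff_etaOddMC_of_cm` (from BT26 Thm. 2.6
# read at η ∧ Kobayashi Thm. 2.2 at η = the route's own item 19867 `PublishedInputsEtaUpToP`) applies.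

PLANNER SKETCH (seat bsd-inputs-plan-2 g2, D-0154 §C T2 «ISB-Kob74@CM»; NOT proposed by the planner —
the landing is the §C prover's after the ISB pen's word). Theorems only; 0 defs; 0 sorry. CONDITIONAL on
every displayed hypothesis; BSD is not proved by any of this.

Chain replaced, node by node (proof bodies verbatim from the cited landed files, `h74 ↦ (h26, h22)`):
* `PrintReadingsOfLiterature.kobayashi74Text_of_etaUpToP_of_cm` ← `kobayashi74Text_of_fact` (+ `V.HasCM`);
* `InertBadOddEta.exactReadingAt_of_etaUpToP_of_plusMCEtaK` ← `exactReadingAt_of_kobayashi74_of_plusMCEtaK`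
  (EtaMCPair.lean:93 — the ONE use site; `hCMV : V.HasCM` is already derived there);
* `InertBadOddEta.missingInputAt_IstarZero_of_pairLaw_of_etaUpToP_of_plusMCEtaK_of_ne_two` ←
  `…_of_kobayashi74_…` (IstarZeroOfEtaMC.lean:159);
* `InertBadOddEta.cmInertBad_of_cccOne_of_etaUpToP_of_plusMCEtaK` ← `cmInertBad_of_cccOne_of_kobayashi74_of_plusMCEtaK`
  (AssemblyOfEtaMC.lean:121).
[cite: Kobayashi2003, §4 (p. 8), Thm. 7.4 (p. 13), Thm. 2.2 (p. 5)] [cite: BurungaleTian2026, Thm. 2.6 (p. 5)]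
[cite: KitajimaOtsuki2018, Main Thm. 1.3] [cite: PollackRubin2004, p. 448 (remark)] [cite: Mazur1978, Cor. 4.1]
-/

set_option autoImplicit false
set_option linter.dupNamespace false

noncomputable section

/-! ## §1 The `K_∞`-form text of Thm. 7.4 at `η` ON CM CURVES from (h26, h22) -/

namespace Summit.BirchSwinnertonDyer.BirchSwinnertonDyer.Theorems.PrintReadingsOfLiterature

open scoped Classical
open CongruenceSubgroup WeierstrassCurve Field Literature.NumberTheory.EllipticCurves
  Literature.NumberTheory.EllipticCurves.ModularForms
  Literature.NumberTheory.EllipticCurves.Rank1Residual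
  Literature.NumberTheory.GaloisRepresentations ZpExtension
  Summit.BirchSwinnertonDyer.Rank1Residual Summit.BirchSwinnertonDyer.Rank1Residual.Additive

section Texts

variable (p : ℕ) [Fact p.Prime]

/-- **The `K_∞`-form of Kobayashi Thm. 7.4 at `η` on the Summits object, FOR A CM CURVE, from the two
named facts `h26` (BT26 Thm. 2.6 read at `η`) and `h22` (Kobayashi Thm. 2.2 at `η`) ONLY** — the text
of `kobayashi74Text_of_fact` with `V.HasCM` inserted after `p ≠ 2`.
[cite: Kobayashi2003, Thm. 7.4 (p. 13), §4 (p. 8)] [cite: BurungaleTian2026, Thm. 2.6 (p. 5)] -/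
theorem kobayashi74Text_of_etaUpToP_of_cm
    (h26 : Literature.NumberTheory.EllipticCurves.BurungaleTian2026.thm26_etaKatoSequences_charIdeal_upToP_of_cm)
    (h22 : Literature.NumberTheory.EllipticCurves.Kobayashi2003.thm22_etaSignedSelmerDual_finite_torsion) :
    ∀ (K₀ : Type) [Field K₀] [NumberField K₀] [IsCyclotomicExtension {p} ℚ K₀]
      [(galRange (K := ℚ) K₀).Normal] (η : absoluteGaloisGroup ℚ →* ℤˣ),
      (∀ σ ∈ galRange (K := ℚ) K₀, η σ = 1) → η ≠ 1 →
    ∀ (V : WeierstrassCurve ℚ) [V.IsElliptic] [V.IsGloballyMinimal] {N : ℕ} [NeZero N]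
      {f : CuspForm (Gamma0 N) 2},
      p ≠ 2 → V.HasCM → V.HasGoodReductionAtPrime p → V.frobeniusTrace p = 0 → IsNewformOf V f →
    ∀ (ϖ : ℚ), (if Even (p / 2) then (ϖ : ℝ) * V.realPeriodRat = plusPeriod f
        else (ϖ : ℝ) * V.imaginaryPeriodRat = minusPeriod f) →
    ∀ (κ : ZpExtension ℚ p) (γ : absoluteGaloisGroup ℚ),
      κ.IsCyclotomic → κ.IsTopGenerator γ → γ ∈ galRange (K := ℚ) K₀ →
      IsCyclotomicVariable p γ →
    ((∀ (Lp : IwasawaAlgebra p), IsQuadraticBranchPlusLFunction f p ϖ Lp →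
        ∀ D : EtaSignedSelmerDualData V κ K₀ ℚ_[p] η γ 1, D.charIdeal = Ideal.span {Lp}) ↔
      (∀ (Lm : IwasawaAlgebra p), IsQuadraticBranchMinusLFunction f p ϖ Lm →
        ∀ (D : EtaSignedSelmerDualData V κ K₀ ℚ_[p] η γ (-1)) (L' : IwasawaAlgebra p),
          Lm = PowerSeries.X * L' → D.charIdeal = Ideal.span {L'})) := by
  intro K₀ _ _ _ _ η hηK hη1 V _ _ N _ f hp hCM hgood hap hf ϖ hϖ κ γ hκ hγ hγK hγc
  have hiff := Literature.NumberTheory.EllipticCurves.BurungaleTian2026.thm74_etaEvenMC_iff_etaOddMC_of_cm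
    h26 h22 p K₀ η hηK hη1 V hp hCM hgood hap hf ϖ hϖ κ γ hκ hγ hγK hγc
  constructor
  · intro hEven Lm hLm D L' hLL'
    refine hiff.mp (fun Lp hLp D' ↦ ?_) Lm hLm (toLiterature V κ K₀ ℚ_[p] η γ (-1) D) L' hLL'
    exact hEven Lp hLp (ofLiterature V κ K₀ ℚ_[p] η γ 1 D')
  · intro hOdd Lp hLp D
    refine hiff.mpr (fun Lm hLm D' L' hLL' ↦ ?_) Lp hLp (toLiterature V κ K₀ ℚ_[p] η γ 1 D)
    exact hOdd Lm hLm (ofLiterature V κ K₀ ℚ_[p] η γ (-1) D') L' hLL'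

end Texts

end Summit.BirchSwinnertonDyer.BirchSwinnertonDyer.Theorems.PrintReadingsOfLiterature

/-! ## §2 The exact reading, the typed missing input and the leaf, `h74 ↦ (h26, h22)` -/

namespace Summit.BirchSwinnertonDyer.BirchSwinnertonDyer.Theorems.InertBadOddEta

open scoped Classical NumberField
open CongruenceSubgroup Field Function NumberField IsDedekindDomain IsDedekindDomain.HeightOneSpectrum
  WeierstrassCurve Rat.HeightOneSpectrum
open Literature.NumberTheory.EllipticCurves
open Literature.NumberTheory.EllipticCurves.ModularForms
open Literature.NumberTheory.EllipticCurves.Rank1Residual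
open Literature.NumberTheory.EllipticCurves.Rank1Residual.Typed
open Literature.NumberTheory.GaloisRepresentations
open Literature.NumberTheory.GaloisCohomology
open Literature.NumberTheory.EllipticCurves.IwasawaAlgebra
open ZpExtension
open Summit.BirchSwinnertonDyer.Rank1Residual
open Summit.BirchSwinnertonDyer.Rank1Residual.Additive
open Summit.BirchSwinnertonDyer.Rank1Residual.Additive.LevelBridge
open Summit.BirchSwinnertonDyer.Rank1Residual.X12
open Summit.BirchSwinnertonDyer.Rank1Residual.X12.O10
open Summit.BirchSwinnertonDyer.BirchSwinnertonDyer.Theses.InertBadSignedBranches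
open Summit.BirchSwinnertonDyer.BirchSwinnertonDyer.Theorems.InertBadOdd
open Summit.BirchSwinnertonDyer.BirchSwinnertonDyer.Theorems.PrintReadingsOfLiterature

variable (p : ℕ) [hp : Fact p.Prime]

/-- **The `h1`-free EXACT strict-minus reading on the type `(p, I₀*)` at an odd `p`, from (h26, h22)
instead of the named fact Thm. 7.4** — `exactReadingAt_of_kobayashi74_of_plusMCEtaK` verbatim with the
one line `kobayashi74Text_of_fact p h74` ↦ `kobayashi74Text_of_etaUpToP_of_cm p h26 h22 … hCMV`
(the twin `V = C • W^{(p*)}` of a type-`I₀*` curve is CM: `hasCM_of_smul_quadraticTwist_eq … hT.1`).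
[cite: Kobayashi2003, §4 (p. 8), Thm. 7.4 (p. 13)] [cite: BurungaleTian2026, Thm. 2.6 (p. 5)]
[cite: PollackRubin2004, Theorem and the remark on Sel over ℚ(μ_{p^∞}) (p. 448)] -/
theorem exactReadingAt_of_etaUpToP_of_plusMCEtaK (hp2 : p ≠ 2)
    (h26 : BurungaleTian2026.thm26_etaKatoSequences_charIdeal_upToP_of_cm)
    (h22 : Kobayashi2003.thm22_etaSignedSelmerDual_finite_torsion)
    (hC1K : ∀ (K₀ : Type) [Field K₀] [NumberField K₀] [IsCyclotomicExtension {p} ℚ K₀]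
        [(galRange (K := ℚ) K₀).Normal] (ηχ : absoluteGaloisGroup ℚ →* ℤˣ),
        (∀ σ ∈ galRange (K := ℚ) K₀, ηχ σ = 1) → ηχ ≠ 1 →
      ∀ (V : WeierstrassCurve ℚ) [V.IsElliptic] [V.IsGloballyMinimal] {N : ℕ} [NeZero N]
        {f : CuspForm (Gamma0 N) 2}, V.HasCM →
        p ≠ 2 → V.HasGoodReductionAtPrime p → V.frobeniusTrace p = 0 → IsNewformOf V f →
      ∀ (ϖ : ℚ), (if Even (p / 2) then (ϖ : ℝ) * V.realPeriodRat = plusPeriod f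
          else (ϖ : ℝ) * V.imaginaryPeriodRat = minusPeriod f) →
      ∀ (κ : ZpExtension ℚ p) (γ : absoluteGaloisGroup ℚ),
        κ.IsCyclotomic → κ.IsTopGenerator γ → γ ∈ galRange (K := ℚ) K₀ → IsCyclotomicVariable p γ →
      ∀ (Lp : IwasawaAlgebra p), Additive.IsQuadraticBranchPlusLFunction f p ϖ Lp →
      ∀ D : Additive.EtaSignedSelmerDualData V κ K₀ ℚ_[p] ηχ γ 1,
        D.charIdeal = Ideal.span {Lp})
    {W : WeierstrassCurve ℚ} [W.IsElliptic] [W.IsGloballyMinimal]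
    (hT : HasSignedLocalType W p (.Istar 0)) :
    ∀ (V : WeierstrassCurve ℚ) [V.IsElliptic] [V.IsGloballyMinimal] (C : VariableChange ℚ)
      {N : ℕ} [NeZero N] {f : CuspForm (Gamma0 N) 2},
      p ≠ 2 → C • W.quadraticTwist ((-1) ^ (p / 2) * p) = V →
      V.HasGoodReductionAtPrime p → V.frobeniusTrace p = 0 → IsNewformOf V f →
      ∀ (ϖ : ℚ), (if Even (p / 2) then (ϖ : ℝ) * V.realPeriodRat = plusPeriod f
          else (ϖ : ℝ) * V.imaginaryPeriodRat = minusPeriod f) →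
      ∀ (Lη : IwasawaAlgebra p), IsQuadraticBranchMinusLFunction f p ϖ Lη →
      ∀ (κ : ZpExtension ℚ p) (γ : Field.absoluteGaloisGroup ℚ),
        κ.IsCyclotomic → κ.IsTopGenerator γ → IsCyclotomicVariable p γ →
      ∀ (D : StrictSignedSelmerDualData W κ ℚ_[p] γ (-1)) (L' : IwasawaAlgebra p),
        Lη = PowerSeries.X * L' → D.charIdeal = Ideal.span {L'} := by
  intro V _ _ C N _ f _ hCV hgood hap hf ϖ hϖ Lη hL κ γ hκ hγ hγc D L' hLL'
  haveI : NeZero p := ⟨(Fact.out : p.Prime).ne_zero⟩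
  haveI : IsCyclotomicExtension {p} ℚ (CyclotomicField p ℚ) :=
    CyclotomicField.isCyclotomicExtension p ℚ
  haveI : (galRange (K := ℚ) (CyclotomicField p ℚ)).Normal := normal_galRange_cyclotomic p _
  obtain ⟨θ, ηθ, hθ, hc, hη, hηK, hη1⟩ := SignedTwist.exists_theta_eta_cyclotomicField p hp2
  have hD := SignedTwist.localTowerHyp_padic p κ (CyclotomicField p ℚ) hκ
  have hκ₀ := kappa_surjOn_galRange_cyclotomic κ (CyclotomicField p ℚ)
  have hcop := coprime_index_galRange_cyclotomic p (CyclotomicField p ℚ)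
  obtain ⟨γ', hγ'K, hγ'κ⟩ := hκ₀ (κ γ)
  have hγγ' : γ⁻¹ * γ' ∈ κ.kerSubgroup := by
    rw [ZpExtension.mem_kerSubgroup, map_mul, map_inv, hγ'κ, inv_mul_cancel]
  have hγ' : κ.IsTopGenerator γ' := by rw [ZpExtension.IsTopGenerator, hγ'κ]; exact hγ
  have hγ'c : IsCyclotomicVariable p γ' :=
    SignedTwist.isCyclotomicVariable_of_inv_mul_mem_ker hκ hγγ' hγc
  have hCMV : V.HasCM := hasCM_of_smul_quadraticTwist_eq (Additive.pStar_ne_zero p) hCV hT.1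
  have hEven := hC1K (CyclotomicField p ℚ) ηθ hηK hη1 V hCMV hp2 hgood hap hf ϖ hϖ κ γ' hκ hγ'
    hγ'K hγ'c
  have hOdd := (kobayashi74Text_of_etaUpToP_of_cm p h26 h22 (CyclotomicField p ℚ) ηθ hηK hη1 V hp2
    hCMV hgood hap hf ϖ hϖ κ γ' hκ hγ' hγ'K hγ'c).mp hEven
  have h := hOdd Lη hL
    (D.toEtaSigned W (CyclotomicField p ℚ) hθ hc p κ hCV ηθ hη ℚ_[p] hD hκ₀ hcop hγ'K hγγ') L' hLL'
  rwa [StrictSignedSelmerDualData.toEtaSigned_charIdeal] at h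

/-- **The typed missing input on `(p, I₀*)`, `p` odd, from the pair law ∧ (h26, h22) ∧ KO13 ∧ Mazur ∧
the even MC at `η` for CM curves** — `missingInputAt_IstarZero_of_pairLaw_of_kobayashi74_of_plusMCEtaK_of_ne_two`
verbatim with `h74 ↦ (h26, h22)`. [cite: Kobayashi2003, §4 (p. 8), Thm. 7.4 (p. 13)]
[cite: KitajimaOtsuki2018, Main Thm. 1.3] [cite: BurungaleTian2026, Thm. 2.6 (p. 5)] [cite: Mazur1978, Cor. 4.1] -/
theorem missingInputAt_IstarZero_of_pairLaw_of_etaUpToP_of_plusMCEtaK_of_ne_two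
    (hmod : hasEntireLFunction_rat) (hGZ : GrossZagier1986_thm_I_7_3)
    (hGZK : rank_eq_analyticRank_of_analyticRank_le_one)
    (hPT : poitouTate_selmerStructure_duality_real ℚ) (hnf : exists_isNewformOf)
    (hM : mazur_not_dvd_maninConstant_of_odd)
    (hKO : KitajimaOtsuki2018.mainThm13_etaSignedSelmerDual_noFiniteSubmodule)
    (h26 : BurungaleTian2026.thm26_etaKatoSequences_charIdeal_upToP_of_cm)
    (h22 : Kobayashi2003.thm22_etaSignedSelmerDual_finite_torsion)
    (hC1K : ∀ (K₀ : Type) [Field K₀] [NumberField K₀] [IsCyclotomicExtension {p} ℚ K₀]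
        [(galRange (K := ℚ) K₀).Normal] (ηχ : absoluteGaloisGroup ℚ →* ℤˣ),
        (∀ σ ∈ galRange (K := ℚ) K₀, ηχ σ = 1) → ηχ ≠ 1 →
      ∀ (V : WeierstrassCurve ℚ) [V.IsElliptic] [V.IsGloballyMinimal] {N : ℕ} [NeZero N]
        {f : CuspForm (Gamma0 N) 2}, V.HasCM →
        p ≠ 2 → V.HasGoodReductionAtPrime p → V.frobeniusTrace p = 0 → IsNewformOf V f →
      ∀ (ϖ : ℚ), (if Even (p / 2) then (ϖ : ℝ) * V.realPeriodRat = plusPeriod f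
          else (ϖ : ℝ) * V.imaginaryPeriodRat = minusPeriod f) →
      ∀ (κ : ZpExtension ℚ p) (γ : absoluteGaloisGroup ℚ),
        κ.IsCyclotomic → κ.IsTopGenerator γ → γ ∈ galRange (K := ℚ) K₀ → IsCyclotomicVariable p γ →
      ∀ (Lp : IwasawaAlgebra p), Additive.IsQuadraticBranchPlusLFunction f p ϖ Lp →
      ∀ D : Additive.EtaSignedSelmerDualData V κ K₀ ℚ_[p] ηχ γ 1,
        D.charIdeal = Ideal.span {Lp})
    (hlaw : ∀ (W : WeierstrassCurve ℚ) [W.IsElliptic] [W.IsGloballyMinimal],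
      HasSignedLocalType W p (.Istar 0) → W.analyticRank = 1 →
      ∀ (V : WeierstrassCurve ℚ) [V.IsElliptic] [V.IsGloballyMinimal] (C : VariableChange ℚ)
        {N : ℕ} [NeZero N] {f : CuspForm (Gamma0 N) 2},
        C • W.quadraticTwist ((-1) ^ (p / 2) * p) = V →
        V.HasGoodReductionAtPrime p → V.frobeniusTrace p = 0 → IsNewformOf V f →
        ∀ (ϖ : ℚ), (if Even (p / 2) then (ϖ : ℝ) * V.realPeriodRat = plusPeriod f
            else (ϖ : ℝ) * V.imaginaryPeriodRat = minusPeriod f) →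
        ∀ (L : IwasawaAlgebra p), IsQuadraticBranchMinusLFunction f p ϖ L →
        (∀ Q : (W.baseChange ℚ_[p]).toAffine.Point, p • Q = 0 → Q = 0) →
        ∀ (P : W.toAffine.Point) (n : ℕ), ¬ IsOfFinAddOrder P →
        (∀ R : W.toAffine.Point, ∃ (k : ℤ) (T : W.toAffine.Point), IsOfFinAddOrder T ∧ R = k • P + T) →
        (∃ Q : (W.baseChange ℚ_[p]).toAffine.Point, p ^ n • Q = W.toPadicPoint p P) →
        (∀ Q : (W.baseChange ℚ_[p]).toAffine.Point, p ^ (n + 1) • Q ≠ W.toPadicPoint p P) →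
        ∀ (q : ℚ), shaAn W = (q : ℂ) →
        PowerSeries.coeff 1 L ≠ 0 ∧
          ((PowerSeries.coeff 1 L : ℤ_[p]) : ℚ_[p]).valuation =
            2 * (n : ℤ) + padicValRat p (q * W.tamagawaProduct / (W.torsionOrder : ℚ) ^ 2))
    (hp2 : p ≠ 2) :
    ∀ (W : WeierstrassCurve ℚ) [W.IsElliptic] [W.IsGloballyMinimal],
      HasSignedLocalType W p (.Istar 0) → W.analyticRank = 1 → X12.MissingInputAt W p := by
  refine missingInputAt_IstarZero_of_pairLaw_of_exactReading_of_ne_two p hmod hGZ hGZK hPT hnf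
    (periodRatio_of_mazur_of_ne_two p hM hp2) hlaw
    (fun W _ _ _ _ ↦ oddBranchStrictMinusNoFiniteSubmoduleAt_of_kitajimaOtsuki W p hKO)
    (fun _ _ _ hT _ ↦ exactReadingAt_of_etaUpToP_of_plusMCEtaK p hp2 h26 h22 hC1K hT)
    (fun W _ _ hT ↦ ?_) hp2
  obtain ⟨V, _, _, C, hC, hgood, -⟩ := exists_goodTwist_pStar_of_hasSignedLocalType_IstarZero_of_ne_two W hT hp2
  exact padicValNat_localTamagawaNumber_eq_zero_of_quadraticTwist_signedPrime_of_odd W p hp2 C V hC hgood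

/-- **THE RUNG LEAF K8 `X12.CMInertBad` from the route's cruxes with Kobayashi Thm. 7.4 (η) REPLACED by
the two named facts of item 19867 `PublishedInputsEtaUpToP`** (`h26` = BT26 Thm. 2.6 read at `η`,
`h22` = Kobayashi Thm. 2.2 at `η`) — `cmInertBad_of_cccOne_of_kobayashi74_of_plusMCEtaK` verbatim with
the `p ≥ 5`, type-`I₀*` branch run through the (h26, h22) node. CONDITIONAL; closes nothing by itself.
[cite: Kobayashi2003, §4 (p. 8), Thm. 7.4 (p. 13), Thm. 2.2 (p. 5)] [cite: KitajimaOtsuki2018, Main Thm. 1.3]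
[cite: BurungaleTian2026, Thm. 2.6 (p. 5)] [cite: PollackRubin2004, p. 448 (remark)] [cite: Mazur1978, Cor. 4.1] -/
theorem cmInertBad_of_cccOne_of_etaUpToP_of_plusMCEtaK (h₁ : CccOneLawOnTypeIstarZero)
    (h₂ : InertBadOffType) (h₃ : InertBadAtThree)
    (hC1K : ∀ (p : ℕ) [Fact p.Prime], 5 ≤ p →
      ∀ (K₀ : Type) [Field K₀] [NumberField K₀] [IsCyclotomicExtension {p} ℚ K₀]
        [(galRange (K := ℚ) K₀).Normal] (ηχ : absoluteGaloisGroup ℚ →* ℤˣ),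
        (∀ σ ∈ galRange (K := ℚ) K₀, ηχ σ = 1) → ηχ ≠ 1 →
      ∀ (V : WeierstrassCurve ℚ) [V.IsElliptic] [V.IsGloballyMinimal] {N : ℕ} [NeZero N]
        {f : CuspForm (Gamma0 N) 2}, V.HasCM →
        p ≠ 2 → V.HasGoodReductionAtPrime p → V.frobeniusTrace p = 0 → IsNewformOf V f →
      ∀ (ϖ : ℚ), (if Even (p / 2) then (ϖ : ℝ) * V.realPeriodRat = plusPeriod f
          else (ϖ : ℝ) * V.imaginaryPeriodRat = minusPeriod f) →
      ∀ (κ : ZpExtension ℚ p) (γ : absoluteGaloisGroup ℚ),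
        κ.IsCyclotomic → κ.IsTopGenerator γ → γ ∈ galRange (K := ℚ) K₀ → IsCyclotomicVariable p γ →
      ∀ (Lp : IwasawaAlgebra p), Additive.IsQuadraticBranchPlusLFunction f p ϖ Lp →
      ∀ D : Additive.EtaSignedSelmerDualData V κ K₀ ℚ_[p] ηχ γ 1, D.charIdeal = Ideal.span {Lp})
    (hKO : KitajimaOtsuki2018.mainThm13_etaSignedSelmerDual_noFiniteSubmodule)
    (h26 : BurungaleTian2026.thm26_etaKatoSequences_charIdeal_upToP_of_cm)
    (h22 : Kobayashi2003.thm22_etaSignedSelmerDual_finite_torsion)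
    (h₆ : PublishedFactsInert) :
    X12.CMInertBad := by
  intro W _ _ p _ hCM hr hp2 hin hbad
  have hp : p.Prime := Fact.out
  by_cases h3 : p = 3
  · subst h3
    exact h₃ W hCM hr hin hbad
  · have hp5 : 5 ≤ p := by
      by_contra hlt
      have hlt' : p < 5 := Nat.lt_of_not_le hlt
      interval_cases p
      · exact Nat.not_prime_zero hp
      · exact Nat.not_prime_one hp
      · exact hp2 rfl
      · exact h3 rfl
      · exact absurd hp (by decide)
    by_cases hT : HasSignedLocalType W p (.Istar 0)
    · obtain ⟨hmod, hGZ, hGZK, hPT, hnf, hM⟩ := h₆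
      exact missingInputAt_IstarZero_of_pairLaw_of_etaUpToP_of_plusMCEtaK_of_ne_two p hmod hGZ hGZK hPT
        hnf hM hKO h26 h22 (hC1K p hp5) (pairLaw_of_cccOneLawOnTypeIstarZero h₁ p hp5) hp2 W hT hr
    · exact h₂ W p hCM hr hin hbad hp5 hT

/-- **The by-name glue shape the ISB pen would file as the new support item `LeafBridgeEtaUpToP`**
(route decl names only; `PlusMCEtaK`'s guard `p ≠ 2` restricted to `5 ≤ p` as in
`inertBadSignedBranches_leafBridgeEtaK_proof`): CccOneLawOnTypeIstarZero → InertBadOffType →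
InertBadAtThree → PlusMCEtaK → PublishedInputKO13 → PublishedInputsEtaUpToP → PublishedFactsInert →
X12.CMInertBad. [cite: Kobayashi2003, §4 (p. 8), Thm. 7.4 (p. 13)] [cite: BurungaleTian2026, Thm. 2.6 (p. 5)] -/
theorem cmInertBad_of_cruxes_of_ko13_of_etaUpToP :
    CccOneLawOnTypeIstarZero → InertBadOffType → InertBadAtThree → PlusMCEtaK → PublishedInputKO13 →
      PublishedInputsEtaUpToP → PublishedFactsInert → X12.CMInertBad :=
  fun h₁ h₂ h₃ hK hKO hF h₆ =>
    cmInertBad_of_cccOne_of_etaUpToP_of_plusMCEtaK h₁ h₂ h₃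
      (fun p _ _hp5 K₀ _ _ _ _ η hη hη1 V _ _ _N _ _f hCM hp2 => hK p hp2 K₀ η hη hη1 V hCM) hKO hF.1 hF.2 h₆

end Summit.BirchSwinnertonDyer.BirchSwinnertonDyer.Theorems.InertBadOddEta

end
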